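import Summits.PneNP.PneNP.Theses.DelsarteLasserre
import Literature.Computability.Complexity.ExpCollapseOfPEqNP

/-!
# Route DelsarteLasserre — frame fact `NexpSubsetExpOfNpSubsetP` (stmt-PneNP-2131): `NP ⊆ P ⟹ NEXP ⊆ EXP`

Upward padding (Book 1974; Arora–Barak 2009, Thm. 2.22) in the tree's classes: the Literature theorem
`NEXP_subset_EXP_of_NP_subset_P` (`ExpCollapseOfPEqNP.lean`: `padPre k L ∈ NTIME(2ⁿ) ⊆ NE`, Book's
`NE ⊆ E` from "tally `NP ⊆ P`", `E ⊆ EXP`, closure of `EXP` under `≤ₚ`).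
-/

set_option linter.dupNamespace false -- `Summit.PneNP.PneNP.…`: summit = sub-problem name (D-0017 single-conjunct layout)

namespace Summit.PneNP.PneNP.Theorems

open Literature.Computability.Complexity

/-- **Support item `NexpSubsetExpOfNpSubsetP` of route DelsarteLasserre (stmt-PneNP-2131)**:
`NP ⊆ P → NEXP ⊆ EXP`, by `NEXP_subset_EXP_of_NP_subset_P`.
[cite: Book1974, Theorem 1 (p. 189)] [cite: AroraBarak2009, §2.6.2 (Thm. 2.22)] -/
theorem delsarteLasserre_nexpSubsetExpOfNpSubsetP_proof :
    Summit.PneNP.PneNP.Theses.DelsarteLasserre.NexpSubsetExpOfNpSubsetP := by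
  unfold Summit.PneNP.PneNP.Theses.DelsarteLasserre.NexpSubsetExpOfNpSubsetP
  exact NEXP_subset_EXP_of_NP_subset_P

end Summit.PneNP.PneNP.Theorems
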